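import Mathlib
import HarnessLib
import Summits.NavierStokesRegularity.NavierStokesRegularity.Theorems.TaylorModelRungThreeCertificateStageNumericsSound

/-!
# Crux K1b-DR (stmt-NavierStokesRegularity-23954), line `taylor-model` — certificate SOUNDNESS for the
# `StageNumerics` block, part 1b: the EXIT-FUNCTIONAL clause (U)

The sup of a linear functional over a box is attained coordinatewise: under the box hypotheses of clause (U)
(half-widths `(Λδτs·ω_{k+1} + M_{k+1}·Λδτs·ω₁/as)·2^θ` on the shells `k + 1 ≤ Ka` and
`√(10·Cg·2^(−7(Ka+1)))·2^θ·Λδτs·ω₁/as` on the top shell), every window coordinate of `u` is bounded by `φ` of the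
surrogate half-width `exitHW` (`sn_exitHW_ge`, using `2^θ ≤ φ PU`, `√(…) ≤ φ tv` and the sign guards), hence
`|ℓ (nx j) l u| ≤ Σ_c |ℓ_c|·φ(exitHW_c) ≤ s (nx j) l` by `checkSN_exit` (`sn_exit`; unlisted faces are the zero
functional and unlisted `s` are `0`).

MODEL-lattice bookkeeping only (rung TL-M3); nothing here concerns the Navier–Stokes equations.
-/

-- the sub-problem namespace repeats the summit name by design (D-0017)
set_option linter.dupNamespace false

namespace Summit.NavierStokesRegularity.NavierStokesRegularity.Theorems.TaylorModelCert

open scoped BigOperators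
open Literature.Analysis.FluidPDE.TaoCascade Literature.Analysis.FluidPDE.TaoCascade.TaylorChain

namespace CertTables

/-! ### The EXIT-FUNCTIONAL clause (U) -/

section Exit

variable {K : Type} [Field K] [LinearOrder K] {φ : K →+* ℝ} (hφ : Monotone φ) (T : CertTables K)
  {A : ReadoutAux K} {B : StageAux K}
include hφ

/-- The surrogate half-widths dominate the true half-widths of the exit box, coordinate by coordinate. [folklore] -/
theorem sn_exitHW_ge (hB : T.checkStageAux A B = true) (j : ℕ) (hsc : T.checkSN_scalars j B = true)
    (u : Fin 4 → ℤ → ℝ)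
    (hu : ∀ i k, -T.Kb ≤ k → k + 1 ≤ T.Ka → |u i k| ≤
      ((T.toCertData φ).Λ j * (T.toCertData φ).δ j * (T.toCertData φ).τs * (T.toCertData φ).ω j (1 + k) +
        (T.toCertData φ).M (1 + k) * (T.toCertData φ).Λ j * (T.toCertData φ).δ j * (T.toCertData φ).τs *
          (T.toCertData φ).ω j 1 / (T.toCertData φ).as j) * (2 : ℝ) ^ (T.toCertData φ).θ)
    (hu' : ∀ i, |u i T.Ka| ≤ Real.sqrt (10 * (T.toCertData φ).Cg * (2 : ℝ) ^ (-(7 : ℝ) * (((T.toCertData φ).Ka : ℝ) + 1))) *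
      (2 : ℝ) ^ (T.toCertData φ).θ * (T.toCertData φ).Λ j * (T.toCertData φ).δ j * (T.toCertData φ).τs *
        (T.toCertData φ).ω j 1 / (T.toCertData φ).as j) :
    ∀ c < T.n, |T.wv u c| ≤ φ (T.exitHW j A B c) := by
  obtain ⟨hKb, hKa, -, -, -, -, -, -, ⟨hη, hτ, hCb, hCg⟩, hM, -⟩ := T.sn_aux hB
  simp only [checkSN_scalars, Bool.and_eq_true, decide_eq_true_eq, allN_eq_true] at hsc
  obtain ⟨⟨⟨⟨⟨⟨⟨⟨⟨⟨-, -⟩, -⟩, -⟩, hΛ⟩, hδ⟩, hω⟩, -⟩, -⟩, has⟩, -⟩ := hsc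
  have hPU := T.sn_two_rpow_theta_le hφ hB
  have htv := T.sn_tail_le hφ hB
  have h1W : -T.Kb ≤ (1 : ℤ) ∧ (1 : ℤ) ≤ T.Ka := ⟨by linarith, hKa⟩
  have hw1 : (T.toCertData φ).ω j 1 = φ (T.w1 j) := T.sn_ω φ j 1
  -- the common factor `L·ω₁/as ≥ 0` and `L ≥ 0`
  set L : K := (T.stage j).Λ * (T.stage j).δ * T.τs with hL
  have hL0 : 0 ≤ φ L := by
    rw [hL, map_mul, map_mul]
    exact mul_nonneg (mul_nonneg (phi_nonneg hφ hΛ) (phi_nonneg hφ hδ)) (phi_nonneg hφ hτ)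
  have hw10 : 0 ≤ T.w1 j := by
    show 0 ≤ T.wShell j 1
    rw [T.sn_wShell_of_InW j h1W]
    exact (hω _ (T.toNat_shell_lt_m h1W)).le
  have hLR : (T.toCertData φ).Λ j * (T.toCertData φ).δ j * (T.toCertData φ).τs = φ L := by
    rw [toCertData_Λ, toCertData_δ, toCertData_τs, hL, map_mul, map_mul]
  intro c hc
  have hk := T.InW_wk hc
  unfold exitHW
  by_cases hup : c % T.m + 1 < T.m
  · -- interior shell: `k + 1 ≤ Ka`
    rw [if_pos hup]
    have hk1 : T.wk c + 1 ≤ T.Ka := by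
      have := T.m_eq_of_InW hk; unfold wk; omega
    have hb := hu (T.wi c) (T.wk c) hk.1 hk1
    have h1k : -T.Kb ≤ 1 + T.wk c ∧ 1 + T.wk c ≤ T.Ka := ⟨by linarith [hk.1], by linarith⟩
    -- identify the real factors with table entries
    have hω1k : (T.toCertData φ).ω j (1 + T.wk c) = φ (T.wgt j (c + 1)) := by
      rw [T.sn_ω φ, T.sn_wShell_of_InW j h1k]
      unfold wgt
      congr 2
      have e1 : (1 + T.wk c + T.Kb).toNat = c % T.m + 1 := by unfold wk; omega
      have hm2 : 1 % T.m = 1 := Nat.one_mod_eq_one.2 (by omega)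
      rw [e1, Nat.add_mod, hm2, Nat.mod_eq_of_lt hup]
    have hM1k : (T.toCertData φ).M (1 + T.wk c) = φ (T.Mw (c % T.m + 1)) := by
      rw [T.sn_M φ h1k]
      congr 2
      unfold wk; omega
    have hcoef0 : 0 ≤ φ L * φ (T.wgt j (c + 1)) + φ (T.Mw (c % T.m + 1)) * φ L * φ (T.w1 j) / φ (T.stage j).as := by
      have hwg : 0 ≤ φ (T.wgt j (c + 1)) := by
        unfold wgt
        have : (c + 1) % T.m < T.m := Nat.mod_lt _ (T.m_pos_of_InW hk)
        exact phi_nonneg hφ (hω _ this).le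
      have hMw : 0 ≤ φ (T.Mw (c % T.m + 1)) := by
        unfold Mw
        exact phi_nonneg hφ (hM _ (by have := Nat.mod_lt c (T.m_pos_of_InW hk); omega))
      have := phi_nonneg hφ hw10
      have := phi_pos hφ has
      positivity
    calc |T.wv u c| = |u (T.wi c) (T.wk c)| := rfl
      _ ≤ _ := hb
      _ = (φ L * φ (T.wgt j (c + 1)) + φ (T.Mw (c % T.m + 1)) * φ L * φ (T.w1 j) / φ (T.stage j).as) *
            (2 : ℝ) ^ (T.toCertData φ).θ := by
          rw [hω1k, hM1k, hw1, sn_as, toCertData_Λ, toCertData_δ, toCertData_τs, hL, map_mul, map_mul]; ring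
      _ ≤ (φ L * φ (T.wgt j (c + 1)) + φ (T.Mw (c % T.m + 1)) * φ L * φ (T.w1 j) / φ (T.stage j).as) *
            φ B.PU := mul_le_mul_of_nonneg_left hPU hcoef0
      _ = φ ((L * T.wgt j (c + 1) + T.Mw (c % T.m + 1) * L * T.w1 j / (T.stage j).as) * B.PU) := by
          simp [map_mul, map_add, map_div₀]
  · -- top shell: `k = Ka`
    rw [if_neg hup]
    have hkKa : T.wk c = T.Ka := by
      have := T.m_eq_of_InW hk
      have : c % T.m + 1 = T.m := by have := Nat.mod_lt c (T.m_pos_of_InW hk); omega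
      unfold wk; omega
    have hb := hu' (T.wi c)
    have hcoef0 : 0 ≤ (2 : ℝ) ^ (T.toCertData φ).θ * φ L * φ (T.w1 j) / φ (T.stage j).as := by
      have := phi_nonneg hφ hw10
      have := phi_pos hφ has
      positivity
    have hcoef1 : 0 ≤ φ A.tv * φ L * φ (T.w1 j) / φ (T.stage j).as := by
      obtain ⟨-, -, -, -, -, -, -, ⟨ht0, -⟩, -⟩ := T.sn_aux hB
      have := phi_nonneg hφ hw10
      have := phi_pos hφ has
      have := phi_nonneg hφ ht0
      positivity
    calc |T.wv u c| = |u (T.wi c) (T.wk c)| := rfl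
      _ = |u (T.wi c) T.Ka| := by rw [hkKa]
      _ ≤ _ := hb
      _ = Real.sqrt (10 * (T.toCertData φ).Cg * (2 : ℝ) ^ (-(7 : ℝ) * (((T.toCertData φ).Ka : ℝ) + 1))) *
            ((2 : ℝ) ^ (T.toCertData φ).θ * φ L * φ (T.w1 j) / φ (T.stage j).as) := by
          rw [hw1, sn_as, toCertData_Λ, toCertData_δ, toCertData_τs, hL, map_mul, map_mul]; ring
      _ ≤ φ A.tv * ((2 : ℝ) ^ (T.toCertData φ).θ * φ L * φ (T.w1 j) / φ (T.stage j).as) :=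
          mul_le_mul_of_nonneg_right htv hcoef0
      _ = (2 : ℝ) ^ (T.toCertData φ).θ * (φ A.tv * φ L * φ (T.w1 j) / φ (T.stage j).as) := by ring
      _ ≤ φ B.PU * (φ A.tv * φ L * φ (T.w1 j) / φ (T.stage j).as) :=
          mul_le_mul_of_nonneg_right hPU hcoef1
      _ = φ (A.tv * B.PU * L * T.w1 j / (T.stage j).as) := by
          simp [map_mul, map_div₀]; ring

/-- Soundness of `checkSN_exit`: the exit-functional clause (U) of `StageNumerics` at stage `j`. [folklore] -/
theorem sn_exit (hB : T.checkStageAux A B = true) (j : ℕ) (hsc : T.checkSN_scalars j B = true)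
    (h : T.checkSN_exit j A B = true) :
    ∀ u : Fin 4 → ℤ → ℝ,
      (∀ i k, -(T.toCertData φ).Kb ≤ k → k + 1 ≤ (T.toCertData φ).Ka → |u i k| ≤
        ((T.toCertData φ).Λ j * (T.toCertData φ).δ j * (T.toCertData φ).τs * (T.toCertData φ).ω j (1 + k) +
          (T.toCertData φ).M (1 + k) * (T.toCertData φ).Λ j * (T.toCertData φ).δ j * (T.toCertData φ).τs *
            (T.toCertData φ).ω j 1 / (T.toCertData φ).as j) * (2 : ℝ) ^ (T.toCertData φ).θ) →
      (∀ i, |u i (T.toCertData φ).Ka| ≤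
        Real.sqrt (10 * (T.toCertData φ).Cg * (2 : ℝ) ^ (-(7 : ℝ) * (((T.toCertData φ).Ka : ℝ) + 1))) *
          (2 : ℝ) ^ (T.toCertData φ).θ * (T.toCertData φ).Λ j * (T.toCertData φ).δ j * (T.toCertData φ).τs *
            (T.toCertData φ).ω j 1 / (T.toCertData φ).as j) →
      ∀ l, |(T.toCertData φ).ℓ ((T.toCertData φ).nx j) l u| ≤ (T.toCertData φ).s ((T.toCertData φ).nx j) l := by
  intro u hu hu' l
  simp only [checkSN_exit, Bool.and_eq_true, decide_eq_true_eq, allN_eq_true] at h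
  obtain ⟨hs, hsum⟩ := h
  have hHW := T.sn_exitHW_ge hφ hB j hsc u hu hu'
  rw [sn_ℓ, sn_nx, sn_s]
  set Gn := T.stage (T.stage j).nx with hGn
  by_cases hl : l < Gn.ell.length
  · calc |T.covR φ (Gn.ell.getD l []) u|
        ≤ ∑ c ∈ Finset.range T.n, |φ (vget (Gn.ell.getD l []) c)| * φ (T.exitHW j A B c) :=
          T.abs_covR_le φ _ u _ hHW
      _ = φ (sumN T.n fun c => |vget (Gn.ell.getD l []) c| * T.exitHW j A B c) := by
          rw [phi_sumN]
          refine Finset.sum_congr rfl fun c _ => ?_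
          rw [map_mul, phi_abs hφ]
      _ ≤ φ (vget Gn.s l) := hφ (hsum l hl)
  · rw [List.getD_eq_default _ _ (not_lt.1 hl), T.covR_nil φ]
    simp only [abs_zero]
    by_cases hl' : l < Gn.s.length
    · exact phi_nonneg hφ (hs l hl')
    · rw [vget_of_le _ (not_lt.1 hl'), map_zero]

end Exit

end CertTables

end Summit.NavierStokesRegularity.NavierStokesRegularity.Theorems.TaylorModelCert
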